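import Mathlib
import HarnessLib
import HarnessLib.Audit
import Summits.AtomisticToContinuum.Statement
import Literature.MathematicalPhysics.QuantumManyBody.GroundStateFeynmanKac
import Literature.MathematicalPhysics.QuantumManyBody.PeriodicBoseGasFourier
import HarnessLib.Audit.Status.Attr

/-!
Route: BECCovarianceTransport

DORMANT since 2026-08-29T19:24:57Z (census g0: costume|duplicate of —; reader census-reader-31-g0) — unstaffed, not closed; items shared with open routes are served there. `ledger route dormant <id> --off` reactivates.

# Route BECCovarianceTransport — transport the zero-mode occupation along the torus imaginary-time
Feynman–Kac flow by exact covariance identities with shell-wise relaxation times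

X_T = EnergyExcessDecay ∧ SoftShellRelaxation ∧ HardModeBounds ("it suffices to show X_T", given the
two shared torus→conjunct items PeriodicRigidity and BoundaryTransferWeak); realises card
imaginary-time-flow-covariance-transport (conforming re-open, D-0027 §2.1, of route
BECImaginaryTimeTransport retired 2026-08-15T13:39Z `not-a-thesis`, now on the TORUS and with a
deciding theorem). Let Φ_t := e^{-tH}1 be the imaginary-time flow of the CONSTANT function on the
torus of side L = (N/ρ)^{1/3} — the explicit positive Feynman–Kac expectation Φ_t(X) = E[exp(−∫₀ᵗ
Σ_{i<j} v^per(Bⁱ_s − Bʲ_s) ds)] over N independent world-lines Bⁱ = Xᵢ + √2 bⁱ (typed over the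
tree's `worldLine`/`wienerPaths`/`expNeg`/`periodicInteraction`; ħ = 2m = 1, c = √(16πρa), κ = 1/ξ =
√(8πρa), a = scattering length), Z(t) = ∫_{cell^N} Φ_t², E_t = −(log Z)′(t)/2 the energy of the
normalised flow state. X_T consists of three A-PRIORI BOUNDS on this family, uniform in L for ρ <
ρ₀(v): (C1′) ENERGY-EXCESS DECAY E_t − E_∞ ≤ C L³c⁻³t⁻⁴ for t ≥ Cc⁻² (stated derivative-free through
finite differences of log Z; the time-integrated form of the card's Var_t(H) ≲ L³c⁻³t⁻⁵ —
pseudo-thermal phonons at T_eff = 1/(4t), a Stefan–Boltzmann t⁻⁴); (C2) every dyadic plane-wave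
shell k_j/2 < |k| ≤ k_j = 2⁻ʲκ has occupation ≤ C L³ck_j² and number variance ≤ C L³c²k_j from its
own relaxation time T_j = C/(ck_j) on; (C2h) the hard modes |k| > κ carry ≤ C N√(ρa³) particles with
variance ≤ CN from t ≥ Cc⁻² on. The exact identities d⟨A⟩_t/dt = −2Re Cov_t(H, A), |Cov| ≤ σ(H)σ(A),
dE_t/dt = −2Var_t(H), applied shell by shell from T_j and telescoped (CovarianceTransportLemma +
TransportBookkeeping) give zero-mode occupation ≥ N(1 − C(ρa³)^{1/4}) for the flow states at all
large t, hence condensing periodic near-minimisers of every slack (target FlowCondensate);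
PeriodicRigidity upgrades "some near-minimisers" to "all" (RigidityUpgrade), i.e. the PeriodicBEC
hypothesis of BoundaryTransferWeak, which delivers the Dirichlet conjunct.
Lean: `EnergyExcessDecay ∧ SoftShellRelaxation ∧ HardModeBounds`

## Assembly
Function application only (certified in glue.lean, axioms {propext, Classical.choice, Quot.sound}):
TransportBookkeeping turns the three flow cruxes into FlowCondensate; RigidityUpgrade with
PeriodicRigidity turns FlowCondensate into the PeriodicBEC hypothesis of BoundaryTransferWeak for
each admissible v; BoundaryTransferWeak returns ∃ρ₀ ∀ρ<ρ₀ HasGroundStateBEC v ρ, which is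
`BoseEinsteinCondensation` unfolded: `closes h₁ … h₇ := fun v hv => h₇ v hv (h₆ (h₄ h₁ h₂ h₃) h₅ v
hv)`.

Rationale: WHY THIS LINE. Every rigorous passage "finite object ⇒ ground-state condensation" in print is
gap-based (depletion ≤ L² × excess energy: LiebSeiringerSolovejYngvason2005 Thm 5.1, Fournais2020,
Junge2026 = arXiv:2603.20776, arXiv:2510.20493) and stops at boxes tied to the density (barrier
KineticGapLengthScales). This line replaces the gap by TIME: integrate the exact pure-state identity
d⟨A⟩_t/dt = −2Re Cov_t(H,A) along Φ_t = e^{-tH}1 from the constant state of the torus (the exact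
condensate mode by translation invariance), so the ground state enters only as t → ∞ and L enters
only through a dyadic shell sum that the linear phonon dispersion makes convergent uniformly in L
(shell j costs ∼ L³ck_j², Σ_j = O(N√(ρa³)); the one-shot version fails by the
Giorgini–Pitaevskii–Stringari pseudo-thermal anomaly of unrelaxed modes,
GiorginiPitaevskiiStringari1998 — the shell-wise start times are the repair recorded on the card).
Imported areas: stochastic analysis / Feynman–Kac (Wiener expectation over independent world-lines,
Ginibre1965 technology at finite time, AdamsBruKonig2006 / AdamsKonig2007 for the same path family
at the large-deviation level, the tree's GroundStateFeynmanKac files), projector/reptation quantum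
Monte Carlo lore (local-energy variance decay along e^{-tH}: BaroniMoroni1999,
SarsaSchmidtMagro2000, McMillan1965), Laplace-transform convexity (log Z convex, E_t ↓), and
Bogoliubov phonon kinematics only as the bookkeeping that fixes T_j. Versus the retired gen-1 route:
the flow is moved from the Dirichlet box (where the GP-flattened condensate makes the sine-mode
shells and the energy-variance law wrong: overlap² of the interacting condensate with ∏sin is ≈ 0.53
and the sin²-profile interaction excess is O(E₀)) to the torus, C1 is restated in the integrated
derivative-free form the bookkeeping actually consumes, and the conjunct is reached through the
shared items PeriodicRigidity (stmt-AtomisticToContinuum-8958) and BoundaryTransferWeak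
(stmt-AtomisticToContinuum-0827) with a proved `closes`. Versus open routes: no coercivity /
n₊-penalty, no infrared BOUND on near-minimisers as hypothesis (BECInfraredBound, BECIroning,
BECLaplacianL1, BECPhononFloor ask shape/size laws of Ψ₀'s momentum distribution; here C2 is asked
of the explicit state Φ_t, closer to the product state than Ψ₀ is), no RP, no landscape/−log Ψ₀
control (BECMeanFieldControl, BECNewtonPolicyIteration), no thermal states (BECClassicalWindow);
negatives index (6 entries, BEC: SwapJensen only) not touched.

RANKED CRUXES. #0 FlowCondensate (target) — X_T's flow-free typed consequence on the torus: for
every repulsive finite-range v there is ρ₀ > 0 such that for 0 < ρ < ρ₀ there is c > 0 with, for all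
large N and EVERY slack δ > 0, SOME periodic δ-near-minimiser Ψ of the N-body energy on the torus of
side (N/ρ)^{1/3} has zero-mode occupation ⟨Ψ, n₀Ψ⟩ ≥ cN (the ground state reached by the flow
condenses; in the intended proof Ψ is a C¹ approximant of Φ_t/‖Φ_t‖, t large). (why it might fail:
it is zero-mode BEC for the flow-reached torus ground state itself (open 75+ years); false if the
thermodynamic-limit ground state of some admissible v at small ρ is depleted/fragmented
(quantum-solid-like order at low density).) [LiebSeiringerSolovejYngvason2005, Fournais2020,
Junge2026, arXiv:2510.20493]
#2 EnergyExcessDecay (crux) — (card C1, time-integrated) ENERGY-EXCESS DECAY ALONG THE TORUS FLOW.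
For every repulsive finite-range v there are C, ρ₀ > 0 such that for 0 < ρ < ρ₀ and all large N,
with L = (N/ρ)^{1/3}, a = scattering length, c = √(16πρa), Φ_t(X) = E[expNeg(∫₀ᵗ periodicInteraction
v L (worldLine X ω s) ds)] over the canonical Wiener paths and Z(t) = ∫_{cell^N} Φ_t²: for all t ≥
Cc⁻² and 0 < h ≤ h′, (log Z(t) − log Z(t+h))/h − (log Z(t) − log Z(t+h′))/h′ ≤ 2C L³c⁻³t⁻⁴. Since
log Z is convex with −(log Z)′/2 = E_t = ⟨H⟩ in the normalised flow state, this says exactly E_t −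
E_∞ ≤ C L³c⁻³t⁻⁴ (sup over h ↓ 0, inf over h′ ↑ ∞), derivative- and limit-free. Bogoliubov value:
E_t − E₀ = Σ_k ω_k r_k/(1 − r_k), r_k = λ_k²e^{−4ω_kt}, ≈ (π²/7680) L³c⁻³t⁻⁴ (Planck sum at T_eff =
1/(4t)); the two-body t^{−1/2} tail of modes |k| > c is cut off at t ≈ c⁻². [difficulty: XL] (why it
might fail: two-sided statement on the spectral measure of the constant state far beyond the cluster
radius ρat ≲ 1: fails if the two-body t^{-1/2} relaxation tail is not cut off collectively at t ≈
ξ², if a slow non-phonon soft branch exists, or if an extra power of L (L⁴, log L) appears.)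
[BaroniMoroni1999, SarsaSchmidtMagro2000, GiorginiPitaevskiiStringari1998, Ginibre1965,
AdamsBruKonig2006, LiebSeiringerSolovejYngvason2005]
#3 SoftShellRelaxation (crux) — (card C2, soft part) SHELL RELAXATION STATISTICS ON THE TORUS. Same
flow with N = M + 2 ≥ 2, κ = √(8πρa), plane waves e_n (n ∈ ℤ³, |k_n| = 2π|n|/L), normalised modes
L^{-3/2}e_n, dyadic shells B_j = {n : k_j/2 < |k_n| ≤ k_j}, k_j = 2⁻ʲκ: for every j, every finite S
⊆ B_j and all t ≥ C/(ck_j): ⟨N_S⟩_t ≤ C L³ck_j² and ⟨N_S²⟩_t ≤ ⟨N_S⟩_t² + C L³c²k_j, where ⟨N_S⟩_t =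
Σ_{n∈S} cellOccupation of mode n in Φ_t divided by Z(t) and ⟨N_S²⟩ − ⟨N_S⟩ is the explicit two-body
pair occupation (M+2)(M+1)Σ_{n,m∈S}∫_{cell^M}|⟨e_n⊗e_m, Φ_t(·,·,Y)⟩|²dY / Z(t). Bogoliubov orders:
relaxed-shell occupation ≈ 3L³ck_j²/(64π²), variance ≈ #B_j·2(c/4k)² ∼ L³c²k_j; occupations rise
monotonically (no overshoot), variances lose the pseudo-thermal (1/(4ckt))² enhancement exactly for
t ≳ 1/(ck_j). [difficulty: XL] (why it might fail: needs Bogoliubov-size occupations AND normal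
(non-pseudo-thermal) number variances of every relaxed plane-wave shell down to k = 2π/L, uniformly
in t ≥ T_j and L; cubic phonon coupling to the still-unrelaxed lower shells could inflate a relaxed
shell's variance beyond C L³c²k_j.) [GiorginiPitaevskiiStringari1998,
LiebSeiringerSolovejYngvason2005, FournaisSolovej2020, Junge2026]
#4 HardModeBounds (crux) — (card C2 hard part / C3 output) HARD-MODE BOUNDS ON THE TORUS. Same flow
and modes: for every finite S ⊆ {n : |k_n| > κ} and all t ≥ Cc⁻²: ⟨N_S⟩_t ≤ C N√(ρa³) and ⟨N_S²⟩_t ≤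
⟨N_S⟩_t² + CN (N = M + 2). Expected mechanism up to t ≈ ξ²: a Ginibre-type cluster expansion of the
2t-long interacting Brownian paths with constant initial law (small parameter = expected number of
distinct partners met = ρat; Boltzmann statistics — no permutations since the initial state is
symmetric), which also yields E_t to LHY precision; beyond ξ², propagation by the monotone structure
of the flow. Bogoliubov value of the hard depletion ≈ 0.4 N√(ρa³). [difficulty: XL] (why it might
fail: uniformity in t beyond the cluster-expansion radius ρat ≲ 1 is unproved; the LHY-size
depletion N√(ρa³) of the modes |k| > κ must not be transiently exceeded while the soft shells
relax.) [Ginibre1965, AdamsBruKonig2006, FournaisSolovej2020, LiebSeiringerSolovejYngvason2005]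
#5 PeriodicRigidity (crux) — (shared verbatim with stmt-AtomisticToContinuum-8958 of routes
BECMeanFieldControl / BECNewtonPolicyIteration) ∀ admissible v ∃ρ₀ ∀ρ<ρ₀ ∀ᶠN ∀η>0 ∃δ>0: any two
periodic δ-near-minimisers Ψ, Φ on the torus of side (N/ρ)^{1/3} satisfy ∫_{cell^N}|Ψ − cΦ|² ≤ η for
some unit complex c (fixed-N uniqueness + spectral gap of the torus ground state: compact resolvent,
positivity-improving semigroup for bounded v; hard cores via energetic dominance / connectivity of
the dilute component of configuration space). It is what turns "the flow-reached ground state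
condenses" into "every near-minimiser condenses". [difficulty: M] (why it might fail: routine for
bounded v (compact resolvent + Perron–Frobenius), but v may be ⊤ (hard cores): {V<∞} may disconnect
and the torus ground state degenerate; uniqueness of the fluid component as minimiser at every large
N is open (BBK2013, DLM2010).) [ReedSimonIV1978, BaryshnikovBubenikKahle2013,
DiaconisLebeauMichel2010, Kahle2012, LiebSeiringerSolovejYngvason2005]
#6 BoundaryTransferWeak (crux) — (shared verbatim with stmt-AtomisticToContinuum-0827, wanted by ≥
10 torus routes) for each repulsive finite-range v, PeriodicBEC(v) — ∃ρ₀ ∀ρ<ρ₀ ∃c>0 ∀ᶠN ∃δ>0: every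
periodic δ-near-minimiser has zero-mode occupation ≥ cN — implies ∃ρ₀>0 ∀ρ∈(0,ρ₀) HasGroundStateBEC
v ρ (Dirichlet ground state, λ_max(γ) ≥ cN via condensateNumber). Not glue: Dirichlet/periodic
energies differ by a wall term ≫ the slack; expected proof by Neumann bracketing of interior
sub-boxes plus a mode-free criterion λ_max ≥ tr γ²/N. [difficulty: L] (why it might fail: the torus
hypothesis never fires on the Dirichlet ground state (wall energy ≫ δ above E₀^per; interior
restrictions are neither periodic nor sharp-N): no energy-comparison proof; needs a structural
transfer (Neumann bracketing + mode-free λ_max ≥ tr γ²/N) not in print.)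
[LiebSeiringerSolovejYngvason2005, Basti2022, BoccatoSeiringer2023, Junge2026, Fournais2020,
Robinson1976]
#9 CovarianceTransportLemma (support) — (card S1, abstract engine, energy form) for self-adjoint H,
A on a finite-dimensional complex Hilbert space, Φ_t = e^{-tH}Φ₀ (Φ₀ ≠ 0) and normalised
expectations ⟨B⟩_t = Re⟨Φ_t, BΦ_t⟩/‖Φ_t‖²: if Var_t(A) = ⟨A²⟩_t − ⟨A⟩_t² ≤ s² on [T₁, T₂] then
|⟨A⟩_{T₂} − ⟨A⟩_{T₁}| ≤ 2s√((T₂ − T₁)(⟨H⟩_{T₁} − ⟨H⟩_{T₂})/2) — from d⟨A⟩_t/dt = −2Re Cov_t(H, A),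
|Cov| ≤ σ(H)σ(A), d⟨H⟩_t/dt = −2Var_t(H) and Cauchy–Schwarz in t. [difficulty: provable-now]
[BaroniMoroni1999, LiebSeiringerSolovejYngvason2005]
#9 TransportBookkeeping (support) — (card S1 + S2, the bookkeeping theorem) EnergyExcessDecay →
SoftShellRelaxation → HardModeBounds → FlowCondensate: the torus FK expectation Φ_t is
e^{-tH_N^per}1 for the Dirichlet-form realisation on the torus (cell translates of the tree's
heat-flow API; spectral representation Z(t) = ∫e^{-2tλ}dμ, so log Z is convex, E_t = −(log Z)′/2 ↓
E_∞ and E_∞ = inf supp μ = periodicGroundStateEnergy because the constant charges the nonnegative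
symmetric ground state and the C¹ periodic class is a form core, hard cores included; d⟨N_S⟩_t/dt =
−2Re Cov_t(H, N_S) with ⟨N_S²⟩ = occ + pair); apply CovarianceTransportLemma (spectral truncation /
dominated convergence) to each shell B_j on [T_j, t] and to the hard part on [Cc⁻², t], with
Var_t(H)-integrals bounded dyadically by EnergyExcessDecay (∫_{T}^{∞}σ_s(H)ds ≤ 1.55√(C L³c⁻³T⁻³));
telescope N = ⟨n₀⟩ + Σ_j⟨N_{B_j}⟩ + ⟨N_hard⟩ by Parseval on the cell (tsum_sq_cellFourierCoeff per
particle slice); sum Σ_j O(L³ck_j²) = O(N√(ρa³)) plus the hard cost O(N(ρa³)^{1/4}) to get ⟨n₀⟩_t ≥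
N/2 for all t ≥ T_J ≈ L/c; finally approximate Φ_t/‖Φ_t‖ by C¹ periodic symmetric states in form
norm with occupation continuity, giving δ-near-minimisers for every δ > 0. [difficulty: XL]
[ChungZhao1995, GlimmJaffeQP1987, Ginibre1965, LiebSeiringerSolovejYngvason2005, ReedSimonIV1978]
#9 RigidityUpgrade (support) — (identification glue) FlowCondensate → PeriodicRigidity → for every
admissible v the PeriodicBEC body (= the hypothesis of BoundaryTransferWeak, verbatim): given N
large take η = c²/16 in PeriodicRigidity to get δ > 0, a condensing δ-near-minimiser Ψ_F from
FlowCondensate, and for any δ-near-minimiser Φ use ∫|Φ − e^{iθ}Ψ_F|² ≤ η with the phase-invariance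
and 2N-Lipschitz continuity of condensateOccupation on normalised states of the cell (it is N‖(P₀ ⊗
1)·‖²) to get ⟨Φ, n₀Φ⟩ ≥ (c − 2√η)N ≥ (c/2)N; ENNReal bookkeeping with ofReal. [difficulty: M]
[LiebSeiringerSolovejYngvason2005, Fournais2020]

TWO-LAYER PLAN. Foreseen glued splits once a crux moves (k ≤ 3, depth 1; nothing filed now):
EnergyExcessDecay ⇐ (window Cc⁻² ≤ t ≤ K/(ρa·c²)-type times inside the time-direction cluster radius
ρat ≲ 1, by a Ginibre expansion of the 2t-long paths) → (t beyond: Laplace-transform/monotone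
structure of log Z plus phonon kinematics of the spectral measure of the constant state) →
EnergyExcessDecay; SoftShellRelaxation ⇐ (occupation half) → (variance half) → SoftShellRelaxation;
HardModeBounds ⇐ (cluster expansion for t ≤ Kξ² delivering the bounds at t = Kξ²) → (propagation to
t ≥ Kξ²) → HardModeBounds; TransportBookkeeping ⇐ (identification layer: torus FK = form semigroup,
spectral representation, E_∞ = periodicGroundStateEnergy, covariance identity for N_S) → (shell
telescoping with CovarianceTransportLemma + Parseval + C¹ approximation) → TransportBookkeeping.
PeriodicRigidity and BoundaryTransferWeak are shared items; their decompositions belong to the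
routes that own them (a bounded-v half of PeriodicRigidity is the natural first child).

KILL CRITERIA. (i) An exactly solvable Bogoliubov-level evaluation (quadratic Hamiltonian, flow of
the particle vacuum = relaxing two-mode squeezed states, r_k = λ_k²e^{−4ω_kt}) exhibiting an extra
power of L or a log L in E_t − E₀ for ξ² ≲ t ≲ L/c, or relaxed-shell variances keeping the
pseudo-thermal (4ckt)⁻² enhancement after T_j, refutes EnergyExcessDecay resp. SoftShellRelaxation
at the Gaussian level — close `refuted:<Decl>` (the scheme, not a constant, is then wrong). (ii) A
theorem that E_t − E_∞ decays no faster than L³t⁻³ in d = 3 (shell-wise ∫σ_t(H)dt then fails to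
converge) kills EnergyExcessDecay and the line. (iii) ¬PeriodicRigidity for some admissible
hard-core v (degenerate torus ground states at infinitely many N) forces a pivot, not a close:
restate FlowCondensate for flows from positive initial data charging each extremal ground state and
upgrade without rigidity. (iv) ¬BoundaryTransferWeak breaks this and every torus route; pivot =
Neumann boxes (flow of the constant again) with a Neumann→Dirichlet bracketing item. (v)
FlowCondensate or the PeriodicBEC body proved by any other route moots cruxes 2–4 and completes this
route through RigidityUpgrade/BoundaryTransferWeak. A proof that C must depend on ρ (e.g. (ρa³)^{−γ}
prefactors) does NOT kill anything: restate with the weaker power as long as Σ_j stays o(N).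

NOT DECOMPOSED YET. The semigroup identification layer (torus FK expectation = e^{-tH^per}, spectral
representation of Z, (log Z)″ = 4Var_t(H), covariance identity for N_S, E_∞ =
periodicGroundStateEnergy incl. hard cores, C¹ approximation of flow states) rides inside
TransportBookkeeping and becomes layer-2 children or `--supports` lemmas once the definition
`BoseGas.periodicHeatFlow` (request below) lands; the finite-time cluster expansion in the time
direction (card C3) as a separate statement shared with other routes; the constants C and the
threshold multiples of c⁻² and 1/(ck_j); model-independence of the Wiener expectation (only the
canonical `wienerPaths` model is used); positive temperature; the Dirichlet-native variant (flow
from the GP-profile product state), kept in reserve for kill criterion (iv).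

CHEAPEST FALSIFIER. Pen-and-paper / kit: run the scheme on the exactly solvable Bogoliubov quadratic
Hamiltonian of the torus (pairs ±k, ω_k = k√(k²+c²), flow of the particle vacuum = two-mode squeezed
states, r_k(t) = λ_k²e^{−4ω_kt}, λ_k = (k² + c²/2 − ω_k)/(c²/2)): E_t − E₀ = Σ_k ω_k r_k/(1 − r_k),
n_k(t) monotone in r_k, Var_t(N_B) from the Gaussian formulas; check with DISCRETE mode sums for L/ξ
= 10 … 10⁴ that (a) (E_t − E₀)c³t⁴/L³ stays bounded (≈ π²/7680 for c⁻² ≪ t ≪ L/c) with no extra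
power of L or log L, (b) shell occupation/variance at t ≥ C/(ck_j) are ≤ C′L³ck_j² and ≤ C′L³c²k_j
with C′ independent of j, L, (c) the dyadic total is O(N√(ρa³)) uniformly in L. Done by hand while
drafting (consistent: unrelaxed modes have 1 − r_k ≈ 4ω_kt for t ≳ c⁻², each contributing 1/(4t);
relaxed shells are quasi-free with u²v² ≈ (c/4k)²; the |k| > c two-body tail ∝ t^{−1/2} dies like
e^{−4c²t} after t ≈ c⁻²); a refuter should script it (kit) — any L⁴ or log L retires the scheme at
the Gaussian level. Second cheapest: PIGS/reptation-QMC measurement of (E_t − E₀)t⁴c³/L³ for hard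
spheres at two box sizes (numerical evidence only).

NUMBERS. ħ = 2m = 1; c = √(16πρa) (Bogoliubov sound speed, ω_k = k√(k² + c²)), κ = 1/ξ = √(8πρa) =
c/√2; thresholds t₀ = Cc⁻² and T_j = C/(ck_j), last shell T_J ≈ L/c; Bogoliubov energy excess E_t −
E₀ ≈ (π²/7680)L³c⁻³t⁻⁴ ≈ 1.3·10⁻³ L³c⁻³t⁻⁴ (Planck sum at T_eff = 1/(4t)); relaxed shell occupation
≈ 3L³ck_j²/(64π²), Σ_j over k_j = 2⁻ʲκ: L³cκ²/(16π²) ≈ 1.13 N√(ρa³) (total Bogoliubov depletion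
(8/(3√π))N√(ρa³) ≈ 1.50 N√(ρa³), of which ≈ 0.4 N√(ρa³) above κ); dyadic ∫_T^∞σ_t(H)dt ≤ (Σ_m
2^{−3m/2})√(C L³c⁻³T⁻³/2) ≈ 1.55√(C L³c⁻³T⁻³); per-shell transport cost ≈ 3.1√(C_V
C_E/C_T³)·L³ck_j²; hard-part transport cost O(N(ρa³)^{1/4}); LHY scale N√(ρa³)
(FournaisSolovej2020); gap-based reach today L ≲ a(ρa³)^{−3/4−η} (Junge2026 Cor. 6); Galilei-boost
ceiling for energy windows 4π²N/L² (KineticGapLengthScalesNarrow (2)–(3)) — respected: every δ is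
chosen after N. Items at open: 10 (1 target, 5 cruxes of which 2 shared, 3 support, 1 assembly).

DEFINITION REQUESTS. `BoseGas.periodicHeatFlow v N L t ψ₀ : Config N → ℂ` (topic
Literature/MathematicalPhysics/QuantumManyBody): the torus analogue of the landed Dirichlet
`BoseGas.heatFlow` (HeatFlow.lean) — the same Wiener expectation over `worldLine`/`wienerPaths` with
`periodicInteraction v L` and NO killing, i.e. e^{-tH_N^per}ψ₀ for Lℤ³-periodic data, with API:
semigroup law, positivity, Bose symmetry, L²(cell^N)-contraction, periodicity preservation, spectral
representation ⟨ψ₀, e^{-tH}ψ₀⟩_{cell} = ∫e^{-tλ}dμ (bounded v; hard cores for t > 0), log-convexity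
of Z, identification of inf supp μ(1) with `periodicGroundStateEnergy`, ground-state projection. To
be filed right after open with `ledger workitem add --kind definition --notion periodicHeatFlow
--topic Literature/MathematicalPhysics/QuantumManyBody --for <TransportBookkeeping item>`; once it
lands the three flow cruxes can be restated in two lines each (tenure). No cite-fact requests: every
fact the flow needs in the tree (`wienerPaths` is a probability measure carrying Brownian
coordinates) is proved.

Novelty: Searches (2026-08-15, this seat): `lit search --hybrid "imaginary time projection ground state Bose
gas energy variance decay condensate"` (12 rows, vector leg only: Pethick–Smith 2008,
Griffin–Snoke–Stringari 1995, Zhai 2021, Benedikter–Porta–Schlein 2016 … — textbook physics, no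
rigorous flow transport); `lit search --source crossref "path integral ground state Monte Carlo
imaginary time projection energy variance Bose"` (11: Apaja 2025 PIGS chapter
doi:10.1088/978-0-7503-6310-5ch6, Baroni–Moroni RQMC chapter
doi:10.1093/oso/9780195310108.003.00120, Rota ISU thesis doi:10.5821/dissertation-2117-94513,
Nho–Landau 2004 doi:10.1103/physreva.70.053614 — numerics); `lit search --source crossref "large
deviations interacting Brownian motions Bose-Einstein condensation Feynman-Kac trace Adams König"`
(10: doi:10.1214/009117906000000214, Adams–König 2008 doi:10.1093/acprof:oso/9780199239252.003.0008,
Del Moral 2004 FK particle recipes); `lit galaxy search "path integral ground state" --star all`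
(14: Martin–Reining–Ceperley *Interacting Electrons*, Baroni arXiv:2209.02799 stochastic
perturbation theory / RQMC prequel, Lutsyshyn arXiv:1612.01355, Corbo–DuBois–Whaley PIGS double well
— numerics/lore); `lit galaxy search "imaginary time evolution of the interacting Bose gas" --star
all` (0); `lit frontier AtomisticToContinuum --since 2022` (BEC frontier: arXiv:2510.20493 kinetic
localisation via Poincaré inequalities, arXiv:2603.20776 Neumann propagation, arXiv:2605.06844 trial
states  [refs: 10.1088/978-0-7503-6310-5ch6, 10.1093/oso/9780195310108.003.00120, 10.5821/dissertation-2117-94513, 10.1103/physreva.70.053614, 10.1214/009117906000000214, 10.1093/acprof:oso/9780199239252.003.0008, 10.1063/1.1704275, 10.1103/PhysRevLett.82.4745, 10.1063/1.481926, 10.1103/PhysRevLett.80.5040, 2209.02799, 1612.01355, 2510.20493, 2603.20776, 2605.06844, doi:10.1088/978-0-7503-6310-5ch6, doi:10.1093/]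

Barriers (technique_class: heat-flow covariance-identity feynman-kac shell-relaxation): - technique_class: heat-flow covariance-identity feynman-kac shell-relaxation
- Literature.Barriers.AtomisticToContinuum.KineticGapLengthScales: evaded — no "gap × depletion ≤
excess energy" step anywhere; the passage finite object ⇒ ground state integrates an exact identity
in t with a dyadically summable ∫σ_t(H)dt; L enters only through the shell sum Σ_j L³ck_j², uniform
because ω_k is linear. Honest price: EnergyExcessDecay is a two-sided statement about the spectral
measure of the constant state down to energies ∼ c/L (the audit's point: it encodes the phonon
density of states uniformly in L).
- Literature.Barriers.AtomisticToContinuum.KineticGapLengthScalesNarrow: the flow cruxes are not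
energy-window statements (their input is the explicit state Φ_t with its full t-derivative
structure, not ⟨Ψ, HΨ⟩ ≤ E₀ + δ); energy windows appear only at FIXED N in FlowCondensate /
PeriodicRigidity / RigidityUpgrade / BoundaryTransferWeak, where δ is chosen AFTER N (below the
Galilei-boost witnesses 4π²N/L² of conjunct (2)), so conjunct (3) does not bite; FlowCondensate is
existential in Ψ, which the boost witnesses do not constrain at all.
- Literature.Barriers.AtomisticToContinuum.EnergyAsymptoticsWithoutCondensation: evaded — nothing is
inferred from the VALUE of E₀ or E_t; used is the decay of E_t − E_∞ of one explicit family together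
with shell statistics; the Lieb–Liniger witness is excluded because in d = 1 the per-shell cost L c
k_j^{d−1}·k_j^{…} does not decay in j (the dyadic

History (route lifecycle, newest last):
- 2026-08-24T23:49:00Z · DORMANT — reconciler: no traction for 7.2 d (last activity item-evidence-added at 2026-08-17T18:55:01Z); parked, not closed — `ledger route dormant route-AtomisticToConti (operator:999:1531327)
- 2026-08-29T03:14:44Z · REACTIVATED — reconciler: reactivated — activity statement-checked at 2026-08-29T01:17:37Z after parking at 2026-08-24T23:49:00Z (operator:999:3411467)
- 2026-08-29T19:24:57Z · DORMANT — census g0: costume|duplicate of —; reader census-reader-31-g0 (operator:999:732085)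

sub-problem: BoseEinsteinCondensation · status: dormant · opened planner-plancard-AtomisticToContinuum-BoseEin-4e560c3c-g2-0 2026-08-15T18:58:30Z · rev 2 · ledger route-AtomisticToContinuum-BECCovarianceTransport
GENERATED by the gate from the ledger (D-0016/17). Provers cite these decls: `theorem foo : Summit.AtomisticToContinuum.BoseEinsteinCondensation.Theses.BECCovarianceTransport.<Decl> := …` in Summits/AtomisticToContinuum/BoseEinsteinCondensation/Theorems/<Name>.lean.
-/

namespace Summit.AtomisticToContinuum.BoseEinsteinCondensation.Theses.BECCovarianceTransport

open scoped BigOperators Topology Manifold Classical MeasureTheory ProbabilityTheory Matrix InnerProductSpace ComplexConjugate ContinuousMap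
open Filter Set Function TopologicalSpace MeasureTheory

attribute [summit_statement] _root_.BoseEinsteinCondensation

/-- item stmt-AtomisticToContinuum-12682 · target · rank 0 · open · by planner
why it might fail: Zero-mode BEC of the flow-reached torus ground state in the thermodynamic limit (∃ condensing δ-near-minimiser ∀δ>0) — the open problem restricted to the torus; false iff some admissible v has a depleted/fragmented dilute ground state (no candidate; Bogoliubov: n₀/N = 1 − 1.50√(ρa³)).
sources: LiebSeiringerSolovejYngvason2005, Fournais2020, Junge2026, arXiv:2510.20493, FournaisSolovej2020
[target] X_T's flow-free typed consequence on the torus: for every repulsive finite-range v there is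
ρ₀ > 0 such that for 0 < ρ < ρ₀ there is c > 0 with, for all large N and EVERY slack δ > 0, SOME
periodic δ-near-minimiser Ψ of the N-body energy on the torus of side (N/ρ)^{1/3} has zero-mode
occupation ⟨Ψ, n₀Ψ⟩ ≥ cN (the ground state reached by the flow condenses; in the intended proof Ψ is
a C¹ approximant of Φ_t/‖Φ_t‖, t large). -/
@[route_item "route-AtomisticToContinuum-BECCovarianceTransport"]
def FlowCondensate : Prop :=
  ∀ v : ℝ → ENNReal, Literature.MathematicalPhysics.QuantumManyBody.BoseGas.IsRepulsiveFiniteRange v → ∃ ρ₀ : ℝ, 0 < ρ₀ ∧ ∀ ρ : ℝ, 0 < ρ → ρ < ρ₀ → ∃ c : ℝ, 0 < c ∧ ∀ᶠ N : ℕ in Filter.atTop, ∀ δ : ENNReal, 0 < δ → ∃ Ψ : Literature.MathematicalPhysics.QuantumManyBody.BoseGas.PeriodicTrialState N (Literature.MathematicalPhysics.QuantumManyBody.BoseGas.sideLength ρ N), Literature.MathematicalPhysics.QuantumManyBody.BoseGas.periodicEnergy v Ψ ≤ Literature.MathematicalPhysics.QuantumManyBody.BoseGas.periodicGroundStateEnergy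 v N (Literature.MathematicalPhysics.QuantumManyBody.BoseGas.sideLength ρ N) + δ ∧ ENNReal.ofReal (c * N) ≤ Literature.MathematicalPhysics.QuantumManyBody.BoseGas.condensateOccupation N (Literature.MathematicalPhysics.QuantumManyBody.BoseGas.sideLength ρ N) Ψ.ψ

/-- item stmt-AtomisticToContinuum-12683 · crux · rank 2 · open · by planner
why it might fail: Asserts the Bogoliubov Planck law E_t−E_∞ ≲ L³c⁻³t⁻⁴ for the constant state's spectral measure down to one two-phonon quantum 4πc/L, uniformly in L; print has the phonon DOS only thermally, T≲ρa, error (ρa)^{5/2}(ρa³)^ν (HaberbergerEtAl2023 Thm 1.1); a log L or beyond-Gaussian correction breaks it.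
sources: HaberbergerEtAl2023, GiorginiPitaevskiiStringari1998, FournaisSolovej2020, BaroniMoroni1999, SarsaSchmidtMagro2000, Ginibre1965
[crux] (card C1, time-integrated) ENERGY-EXCESS DECAY ALONG THE TORUS FLOW. For every repulsive
finite-range v there are C, ρ₀ > 0 such that for 0 < ρ < ρ₀ and all large N, with L = (N/ρ)^{1/3}, a
= scattering length, c = √(16πρa), Φ_t(X) = E[expNeg(∫₀ᵗ periodicInteraction v L (worldLine X ω s)
ds)] over the canonical Wiener paths and Z(t) = ∫_{cell^N} Φ_t²: for all t ≥ Cc⁻² and 0 < h ≤ h′,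
(log Z(t) − log Z(t+h))/h − (log Z(t) − log Z(t+h′))/h′ ≤ 2C L³c⁻³t⁻⁴. Since log Z is convex with
−(log Z)′/2 = E_t = ⟨H⟩ in the normalised flow state, this says exactly E_t − E_∞ ≤ C L³c⁻³t⁻⁴ (sup
over h ↓ 0, inf over h′ ↑ ∞), derivative- and limit-free. Bogoliubov value: E_t − E₀ = Σ_k ω_k
r_k/(1 − r_k), r_k = λ_k²e^{−4ω_kt}, ≈ (π²/7680) L³c⁻³t⁻⁴ (Planck sum at T_eff = 1/(4t)); the
two-body t^{−1/2} tail of modes |k| > c is cut off at t ≈ c⁻². [difficulty: XL] -/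
@[route_item "route-AtomisticToContinuum-BECCovarianceTransport", crux]
def EnergyExcessDecay : Prop :=
  ∀ v : ℝ → ENNReal, Literature.MathematicalPhysics.QuantumManyBody.BoseGas.IsRepulsiveFiniteRange v → ∃ C ρ₀ : ℝ, 0 < C ∧ 0 < ρ₀ ∧ ∀ ρ : ℝ, 0 < ρ → ρ < ρ₀ → ∀ᶠ N : ℕ in Filter.atTop, let L : ℝ := Literature.MathematicalPhysics.QuantumManyBody.BoseGas.sideLength ρ N; let a : ℝ := (Literature.MathematicalPhysics.QuantumManyBody.BoseGas.scatteringLength v).toReal; let c : ℝ := Real.sqrt (16 * Real.pi * ρ * a); let Φ : ℝ → Literature.MathematicalPhysics.QuantumManyBody.BoseGas.Config N → ENNReal := fun t X => ∫⁻ ω, Literature.MathematicalPhysics.QuantumManyBody.BoseGas.expNeg (∫⁻ s in Set.Ioc (0 : ℝ) t, Literature.MathematicalPhysics.QuantumManyBody.BoseGas.periodicInteraction v L (Literature.MathematicalPhysics.QuantumManyBody.BoseGas.worldLine X ω s.toNNReal)) ∂(Literature.MathematicalPhysics.QuantumManyBody.BoseGas.wienerPaths N); let Z : ℝ → ℝ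 := fun t => (∫⁻ X in Literature.MathematicalPhysics.QuantumManyBody.BoseGas.cellN N L, Φ t X ^ 2).toReal; ∀ t h h' : ℝ, C * c⁻¹ ^ 2 ≤ t → 0 < h → h ≤ h' → (Real.log (Z t) - Real.log (Z (t + h))) / h - (Real.log (Z t) - Real.log (Z (t + h'))) / h' ≤ 2 * C * L ^ 3 * c⁻¹ ^ 3 * t⁻¹ ^ 4

/-- item stmt-AtomisticToContinuum-12684 · crux · rank 3 · open · by planner
why it might fail: Bogoliubov-size occupation ≲L³ck_j² AND quasi-free variance ≲L³c²k_j of EVERY plane-wave shell down to k=2π/L, uniformly in L and t≥T_j; shell statistics are in print only in ρ-tied boxes L≲a(ρa³)^{-1/2-ε} (Fournais2020 Thm 1.2, BrCS2022 spectra); IR phonon coupling could add log(κL) to low shells.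
sources: Fournais2020, BrenneckeCaporalettiSchlein2022, BoccatoEtAl2019Acta, FournaisSolovej2020, GiorginiPitaevskiiStringari1998, LiebSeiringerSolovejYngvason2005
[crux] (card C2, soft part) SHELL RELAXATION STATISTICS ON THE TORUS. Same flow with N = M + 2 ≥ 2,
κ = √(8πρa), plane waves e_n (n ∈ ℤ³, |k_n| = 2π|n|/L), normalised modes L^{-3/2}e_n, dyadic shells
B_j = {n : k_j/2 < |k_n| ≤ k_j}, k_j = 2⁻ʲκ: for every j, every finite S ⊆ B_j and all t ≥ C/(ck_j):
⟨N_S⟩_t ≤ C L³ck_j² and ⟨N_S²⟩_t ≤ ⟨N_S⟩_t² + C L³c²k_j, where ⟨N_S⟩_t = Σ_{n∈S} cellOccupation of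
mode n in Φ_t divided by Z(t) and ⟨N_S²⟩ − ⟨N_S⟩ is the explicit two-body pair occupation
(M+2)(M+1)Σ_{n,m∈S}∫_{cell^M}|⟨e_n⊗e_m, Φ_t(·,·,Y)⟩|²dY / Z(t). Bogoliubov orders: relaxed-shell
occupation ≈ 3L³ck_j²/(64π²), variance ≈ #B_j·2(c/4k)² ∼ L³c²k_j; occupations rise monotonically (no
overshoot), variances lose the pseudo-thermal (1/(4ckt))² enhancement exactly for t ≳ 1/(ck_j).
[difficulty: XL] -/
@[route_item "route-AtomisticToContinuum-BECCovarianceTransport", crux]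
def SoftShellRelaxation : Prop :=
  ∀ v : ℝ → ENNReal, Literature.MathematicalPhysics.QuantumManyBody.BoseGas.IsRepulsiveFiniteRange v → ∃ C ρ₀ : ℝ, 0 < C ∧ 0 < ρ₀ ∧ ∀ ρ : ℝ, 0 < ρ → ρ < ρ₀ → ∀ᶠ M : ℕ in Filter.atTop, let L : ℝ := Literature.MathematicalPhysics.QuantumManyBody.BoseGas.sideLength ρ (M + 2); let a : ℝ := (Literature.MathematicalPhysics.QuantumManyBody.BoseGas.scatteringLength v).toReal; let c : ℝ := Real.sqrt (16 * Real.pi * ρ * a); let κ : ℝ := Real.sqrt (8 * Real.pi * ρ * a); let Φ : ℝ → Literature.MathematicalPhysics.QuantumManyBody.BoseGas.Config (M + 2) → ENNReal := fun t X => ∫⁻ ω, Literature.MathematicalPhysics.QuantumManyBody.BoseGas.expNeg (∫⁻ s in Set.Ioc (0 : ℝ) t, Literature.MathematicalPhysics.QuantumManyBody.BoseGas.periodicInteraction v L (Literature.MathematicalPhysics.QuantumManyBody.BoseGas.worldLine X ω s.toNNReal)) ∂(Literature.MathematicalPhysics.QuantumManyBody.BoseGas.wienerPaths (M + 2)); let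 Z : ℝ → ENNReal := fun t => ∫⁻ X in Literature.MathematicalPhysics.QuantumManyBody.BoseGas.cellN (M + 2) L, Φ t X ^ 2; let mode : (Fin 3 → ℤ) → EuclideanSpace ℝ (Fin 3) → ℂ := fun n x => ((Real.sqrt (L ^ 3))⁻¹ : ℂ) * Literature.MathematicalPhysics.QuantumManyBody.BoseGas.cellWave L n x; let kn : (Fin 3 → ℤ) → ℝ := fun n => 2 * Real.pi * Real.sqrt (∑ k : Fin 3, ((n k : ℤ) : ℝ) ^ 2) / L; let occ : Finset (Fin 3 → ℤ) → ℝ → ENNReal := fun S t => (∑ n ∈ S, Literature.MathematicalPhysics.QuantumManyBody.BoseGas.cellOccupation (M + 2) L (mode n) (fun X => ((Φ t X).toReal : ℂ))) / Z t; let pair : Finset (Fin 3 → ℤ) → ℝ → ENNReal := fun S t => ((M + 2 : ENNReal) * (M + 1)) * (∑ n ∈ S, ∑ m ∈ S, ∫⁻ Y in Literature.MathematicalPhysics.QuantumManyBody.BoseGas.cellN M L, (‖∫ x in Literature.MathematicalPhysics.QuantumManyBody.BoseGas.cell L, ∫ y in Literature.MathematicalPhysics.QuantumManyBody.BoseGas.cell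 L, conj (mode n x) * conj (mode m y) * ((Φ t (Matrix.vecCons x (Matrix.vecCons y Y))).toReal : ℂ)‖₊ : ENNReal) ^ 2) / Z t; ∀ j : ℕ, ∀ S : Finset (Fin 3 → ℤ), (∀ n ∈ S, κ * 2⁻¹ ^ j / 2 < kn n ∧ kn n ≤ κ * 2⁻¹ ^ j) → ∀ t : ℝ, C * (c * (κ * 2⁻¹ ^ j))⁻¹ ≤ t → occ S t ≤ ENNReal.ofReal (C * L ^ 3 * c * (κ * 2⁻¹ ^ j) ^ 2) ∧ occ S t + pair S t ≤ occ S t ^ 2 + ENNReal.ofReal (C * L ^ 3 * c ^ 2 * (κ * 2⁻¹ ^ j))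

/-- item stmt-AtomisticToContinuum-12685 · crux · rank 4 · open · by planner
why it might fail: LHY-size bound C·N√(ρa³) (Var ≤ CN) on ALL modes |k|>1/ξ uniformly in t≥Cc⁻² and L: t≲ξ² is inside a Ginibre cluster radius ρat≲1, uniform propagation beyond is unproved; print has no thermodynamic-limit momentum-distribution bound, only 2nd-order ENERGY (FournaisSolovej2020, YauYin2009, BaCS2021).
sources: FournaisSolovej2020, YauYin2009, BastiCenatiempoSchlein2021, Ginibre1965, AdamsBruKonig2006, LiebSeiringerSolovejYngvason2005
[crux] (card C2 hard part / C3 output) HARD-MODE BOUNDS ON THE TORUS. Same flow and modes: for every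
finite S ⊆ {n : |k_n| > κ} and all t ≥ Cc⁻²: ⟨N_S⟩_t ≤ C N√(ρa³) and ⟨N_S²⟩_t ≤ ⟨N_S⟩_t² + CN (N = M
+ 2). Expected mechanism up to t ≈ ξ²: a Ginibre-type cluster expansion of the 2t-long interacting
Brownian paths with constant initial law (small parameter = expected number of distinct partners met
= ρat; Boltzmann statistics — no permutations since the initial state is symmetric), which also
yields E_t to LHY precision; beyond ξ², propagation by the monotone structure of the flow.
Bogoliubov value of the hard depletion ≈ 0.4 N√(ρa³). [difficulty: XL] -/
@[route_item "route-AtomisticToContinuum-BECCovarianceTransport", crux]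
def HardModeBounds : Prop :=
  ∀ v : ℝ → ENNReal, Literature.MathematicalPhysics.QuantumManyBody.BoseGas.IsRepulsiveFiniteRange v → ∃ C ρ₀ : ℝ, 0 < C ∧ 0 < ρ₀ ∧ ∀ ρ : ℝ, 0 < ρ → ρ < ρ₀ → ∀ᶠ M : ℕ in Filter.atTop, let L : ℝ := Literature.MathematicalPhysics.QuantumManyBody.BoseGas.sideLength ρ (M + 2); let a : ℝ := (Literature.MathematicalPhysics.QuantumManyBody.BoseGas.scatteringLength v).toReal; let c : ℝ := Real.sqrt (16 * Real.pi * ρ * a); let κ : ℝ := Real.sqrt (8 * Real.pi * ρ * a); let Φ : ℝ → Literature.MathematicalPhysics.QuantumManyBody.BoseGas.Config (M + 2) → ENNReal := fun t X => ∫⁻ ω, Literature.MathematicalPhysics.QuantumManyBody.BoseGas.expNeg (∫⁻ s in Set.Ioc (0 : ℝ) t, Literature.MathematicalPhysics.QuantumManyBody.BoseGas.periodicInteraction v L (Literature.MathematicalPhysics.QuantumManyBody.BoseGas.worldLine X ω s.toNNReal)) ∂(Literature.MathematicalPhysics.QuantumManyBody.BoseGas.wienerPaths (M + 2)); let Z :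 ℝ → ENNReal := fun t => ∫⁻ X in Literature.MathematicalPhysics.QuantumManyBody.BoseGas.cellN (M + 2) L, Φ t X ^ 2; let mode : (Fin 3 → ℤ) → EuclideanSpace ℝ (Fin 3) → ℂ := fun n x => ((Real.sqrt (L ^ 3))⁻¹ : ℂ) * Literature.MathematicalPhysics.QuantumManyBody.BoseGas.cellWave L n x; let kn : (Fin 3 → ℤ) → ℝ := fun n => 2 * Real.pi * Real.sqrt (∑ k : Fin 3, ((n k : ℤ) : ℝ) ^ 2) / L; let occ : Finset (Fin 3 → ℤ) → ℝ → ENNReal := fun S t => (∑ n ∈ S, Literature.MathematicalPhysics.QuantumManyBody.BoseGas.cellOccupation (M + 2) L (mode n) (fun X => ((Φ t X).toReal : ℂ))) / Z t; let pair : Finset (Fin 3 → ℤ) → ℝ → ENNReal := fun S t => ((M + 2 : ENNReal) * (M + 1)) * (∑ n ∈ S, ∑ m ∈ S, ∫⁻ Y in Literature.MathematicalPhysics.QuantumManyBody.BoseGas.cellN M L, (‖∫ x in Literature.MathematicalPhysics.QuantumManyBody.BoseGas.cell L, ∫ y in Literature.MathematicalPhysics.QuantumManyBody.BoseGas.cell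 L, conj (mode n x) * conj (mode m y) * ((Φ t (Matrix.vecCons x (Matrix.vecCons y Y))).toReal : ℂ)‖₊ : ENNReal) ^ 2) / Z t; ∀ S : Finset (Fin 3 → ℤ), (∀ n ∈ S, κ < kn n) → ∀ t : ℝ, C * c⁻¹ ^ 2 ≤ t → occ S t ≤ ENNReal.ofReal (C * (M + 2) * Real.sqrt (ρ * a ^ 3)) ∧ occ S t + pair S t ≤ occ S t ^ 2 + ENNReal.ofReal (C * (M + 2))

/-- item stmt-AtomisticToContinuum-8958 · crux · rank 5 · open · by planner
why it might fail: Routine for bounded v (positivity improving; fkL2_perronFrobenius needs v≤C) but hard cores are admissible: uniqueness ⟺ ONE component of the N-hard-sphere torus configuration space (mod S_N) strictly minimises the energy at all large N — unprinted at fixed ρa³ (DLM2010, BBK2013); a tie kills it.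
sources: ReedSimonIV1978, BaryshnikovBubenikKahle2013, DiaconisLebeauMichel2010, Kahle2012, LiebSeiringerSolovejYngvason2005, Literature.MathematicalPhysics.QuantumManyBody.BoseGas.fkL2_perronFrobenius
[crux] (card item PI4, torus twin of BECPalmLandscape.GroundStateRigidity =
stmt-AtomisticToContinuum-3298) ∀ admissible v ∃ρ₀ ∀ρ<ρ₀ ∀ᶠ N ∀η>0 ∃δ>0: any two periodic
δ-near-minimisers Ψ, Φ ∈ PeriodicTrialState N L (L = (N/ρ)^{1/3}) satisfy ∫_{cell^N}|Ψ − cΦ|² ≤ η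
for some unit complex c (E₀^per < ∞ at low density, compact resolvent of the torus N-body operator,
unique positive ground state by positivity improvement, spectral gap at fixed N; hard cores via
energetic dominance / connectivity of the dilute component of configuration space). [difficulty: M] -/
@[route_item "route-AtomisticToContinuum-BECCovarianceTransport", crux]
def PeriodicRigidity : Prop :=
  ∀ v : ℝ → ENNReal, Literature.MathematicalPhysics.QuantumManyBody.BoseGas.IsRepulsiveFiniteRange v → ∃ ρ₀ : ℝ, 0 < ρ₀ ∧ ∀ ρ : ℝ, 0 < ρ → ρ < ρ₀ → ∀ᶠ N : ℕ in Filter.atTop, ∀ η : ℝ, 0 < η → ∃ δ : ENNReal, 0 < δ ∧ ∀ Ψ Φ : Literature.MathematicalPhysics.QuantumManyBody.BoseGas.PeriodicTrialState N (Literature.MathematicalPhysics.QuantumManyBody.BoseGas.sideLength ρ N), Literature.MathematicalPhysics.QuantumManyBody.BoseGas.periodicEnergy v Ψ ≤ Literature.MathematicalPhysics.QuantumManyBody.BoseGas.periodicGroundStateEnergy v N (Literature.MathematicalPhysics.QuantumManyBody.BoseGas.sideLength ρ N) + δ → Literature.MathematicalPhysics.QuantumManyBody.BoseGas.periodicEnergy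 v Φ ≤ Literature.MathematicalPhysics.QuantumManyBody.BoseGas.periodicGroundStateEnergy v N (Literature.MathematicalPhysics.QuantumManyBody.BoseGas.sideLength ρ N) + δ → ∃ c : ℂ, ‖c‖ = 1 ∧ ∫⁻ X in Literature.MathematicalPhysics.QuantumManyBody.BoseGas.cellN N (Literature.MathematicalPhysics.QuantumManyBody.BoseGas.sideLength ρ N), (‖Ψ.ψ X - c * Φ.ψ X‖₊ : ENNReal) ^ 2 ≤ ENNReal.ofReal η

/-- item stmt-AtomisticToContinuum-0827 · crux · rank 6 · open · by planner
why it might fail: PeriodicBEC(v) is torus-GS-only (δ after N); the Dirichlet GS as periodic trial state lies a wall energy ≫δ above E₀^per, interior restrictions are neither periodic nor sharp-N: no energy-comparison proof; only the ENERGY transfer is known (LSSY2005 Ch.2, in tree); needs unprinted Neumann bracketing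
sources: LiebSeiringerSolovejYngvason2005, Literature.MathematicalPhysics.QuantumManyBody.BoseGas.LSSY2005_e0_periodic_eq_dirichlet_dilute, BastiCenatiempoSchlein2021, BoccatoSeiringer2023, Junge2026, Fournais2020
[crux] BoundaryTransferWeak (mode-free boundary-condition transfer, per potential): for each
repulsive finite-range v, PeriodicBEC(v) implies ∃ρ₀>0 ∀ρ∈(0,ρ₀) HasGroundStateBEC v ρ (Dirichlet
ground state, λ_max(γ) ≥ cN via condensateNumber). Not glue: near-minimiser slacks are O(N/L²) while
Dirichlet/periodic energies differ by a boundary term ≫ N/L², so no energy-comparison proof;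
expected route: Neumann bracketing of interior sub-boxes (−Δ_Dir ≥ ⊕−Δ_Neu, v ≥ 0) + a mode-free
criterion (λ_max ≥ tr γ²/N). Only the ENERGY analogue is in print (LiebSeiringerSolovejYngvason2005
Ch. 2 after (2.8)). v ≡ 0: hypothesis and conclusion both true. -/
@[route_item "route-AtomisticToContinuum-BECCovarianceTransport", crux]
def BoundaryTransferWeak : Prop :=
  ∀ v : ℝ → ENNReal, Literature.MathematicalPhysics.QuantumManyBody.BoseGas.IsRepulsiveFiniteRange v → (∃ ρ₀ : ℝ, 0 < ρ₀ ∧ ∀ ρ : ℝ, 0 < ρ → ρ < ρ₀ → ∃ c : ℝ, 0 < c ∧ ∀ᶠ N : ℕ in Filter.atTop, ∃ δ : ENNReal, 0 < δ ∧ ∀ Ψ : Literature.MathematicalPhysics.QuantumManyBody.BoseGas.PeriodicTrialState N (Literature.MathematicalPhysics.QuantumManyBody.BoseGas.sideLength ρ N), Literature.MathematicalPhysics.QuantumManyBody.BoseGas.periodicEnergy v Ψ ≤ Literature.MathematicalPhysics.QuantumManyBody.BoseGas.periodicGroundStateEnergy v N (Literature.MathematicalPhysics.QuantumManyBody.BoseGas.sideLength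 ρ N) + δ → ENNReal.ofReal (c * N) ≤ Literature.MathematicalPhysics.QuantumManyBody.BoseGas.condensateOccupation N (Literature.MathematicalPhysics.QuantumManyBody.BoseGas.sideLength ρ N) Ψ.ψ) → ∃ ρ₀ : ℝ, 0 < ρ₀ ∧ ∀ ρ : ℝ, 0 < ρ → ρ < ρ₀ → Literature.MathematicalPhysics.QuantumManyBody.BoseGas.HasGroundStateBEC v ρ

/-- item stmt-AtomisticToContinuum-12686 · support · rank 9 · open · by planner
sources: BaroniMoroni1999, LiebSeiringerSolovejYngvason2005
[support] (card S1, abstract engine, energy form) for self-adjoint H, A on a finite-dimensional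
complex Hilbert space, Φ_t = e^{-tH}Φ₀ (Φ₀ ≠ 0) and normalised expectations ⟨B⟩_t = Re⟨Φ_t,
BΦ_t⟩/‖Φ_t‖²: if Var_t(A) = ⟨A²⟩_t − ⟨A⟩_t² ≤ s² on [T₁, T₂] then |⟨A⟩_{T₂} − ⟨A⟩_{T₁}| ≤ 2s√((T₂ −
T₁)(⟨H⟩_{T₁} − ⟨H⟩_{T₂})/2) — from d⟨A⟩_t/dt = −2Re Cov_t(H, A), |Cov| ≤ σ(H)σ(A), d⟨H⟩_t/dt =
−2Var_t(H) and Cauchy–Schwarz in t. [difficulty: provable-now] -/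
@[route_item "route-AtomisticToContinuum-BECCovarianceTransport"]
def CovarianceTransportLemma : Prop :=
  ∀ (E : Type) [NormedAddCommGroup E] [InnerProductSpace ℂ E] [FiniteDimensional ℂ E] (H A : E →L[ℂ] E), IsSelfAdjoint H → IsSelfAdjoint A → ∀ Φ₀ : E, Φ₀ ≠ 0 → let Φ : ℝ → E := fun t => NormedSpace.exp (-((t : ℂ) • H)) Φ₀; let avg : (E →L[ℂ] E) → ℝ → ℝ := fun B t => (⟪Φ t, B (Φ t)⟫_ℂ).re / ‖Φ t‖ ^ 2; ∀ T₁ T₂ s : ℝ, 0 ≤ T₁ → T₁ ≤ T₂ → 0 ≤ s → (∀ t ∈ Set.Icc T₁ T₂, avg (A * A) t - avg A t ^ 2 ≤ s ^ 2) → |avg A T₂ - avg A T₁| ≤ 2 * s * Real.sqrt ((T₂ - T₁) * (avg H T₁ - avg H T₂) / 2)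

/-- item stmt-AtomisticToContinuum-12687 · support · rank 9 · open · by planner
sources: ChungZhao1995, GlimmJaffeQP1987, Ginibre1965, LiebSeiringerSolovejYngvason2005, ReedSimonIV1978
[support] (card S1 + S2, the bookkeeping theorem) EnergyExcessDecay → SoftShellRelaxation →
HardModeBounds → FlowCondensate: the torus FK expectation Φ_t is e^{-tH_N^per}1 for the
Dirichlet-form realisation on the torus (cell translates of the tree's heat-flow API; spectral
representation Z(t) = ∫e^{-2tλ}dμ, so log Z is convex, E_t = −(log Z)′/2 ↓ E_∞ and E_∞ = inf supp μ
= periodicGroundStateEnergy because the constant charges the nonnegative symmetric ground state and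
the C¹ periodic class is a form core, hard cores included; d⟨N_S⟩_t/dt = −2Re Cov_t(H, N_S) with
⟨N_S²⟩ = occ + pair); apply CovarianceTransportLemma (spectral truncation / dominated convergence)
to each shell B_j on [T_j, t] and to the hard part on [Cc⁻², t], with Var_t(H)-integrals bounded
dyadically by EnergyExcessDecay (∫_{T}^{∞}σ_s(H)ds ≤ 1.55√(C L³c⁻³T⁻³)); telescope N = ⟨n₀⟩ +
Σ_j⟨N_{B_j}⟩ + ⟨N_hard⟩ by Parseval on the cell (tsum_sq_cellFourierCoeff per particle slice); sum
Σ_j O(L³ck_j²) = O(N√(ρa³)) plus the hard cost O(N(ρa³)^{1/4}) to get ⟨n₀⟩_t ≥ N/2 for all t ≥ T_J ≈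
L/c; finally approximate Φ_t/‖Φ_t‖ by C¹ periodic symmetric states in form norm with occupation
continuity, giving δ-near-minimisers for e -/
@[route_item "route-AtomisticToContinuum-BECCovarianceTransport", crux]
def TransportBookkeeping : Prop :=
  EnergyExcessDecay → SoftShellRelaxation → HardModeBounds → FlowCondensate

/-- item stmt-AtomisticToContinuum-12688 · support · rank 9 · open · by planner
sources: LiebSeiringerSolovejYngvason2005, Fournais2020
[support] (identification glue) FlowCondensate → PeriodicRigidity → for every admissible v the
PeriodicBEC body (= the hypothesis of BoundaryTransferWeak, verbatim): given N large take η = c²/16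
in PeriodicRigidity to get δ > 0, a condensing δ-near-minimiser Ψ_F from FlowCondensate, and for any
δ-near-minimiser Φ use ∫|Φ − e^{iθ}Ψ_F|² ≤ η with the phase-invariance and 2N-Lipschitz continuity
of condensateOccupation on normalised states of the cell (it is N‖(P₀ ⊗ 1)·‖²) to get ⟨Φ, n₀Φ⟩ ≥ (c
− 2√η)N ≥ (c/2)N; ENNReal bookkeeping with ofReal. [difficulty: M] -/
@[route_item "route-AtomisticToContinuum-BECCovarianceTransport", crux]
def RigidityUpgrade : Prop :=
  FlowCondensate → PeriodicRigidity → ∀ v : ℝ → ENNReal, Literature.MathematicalPhysics.QuantumManyBody.BoseGas.IsRepulsiveFiniteRange v → ∃ ρ₀ : ℝ, 0 < ρ₀ ∧ ∀ ρ : ℝ, 0 < ρ → ρ < ρ₀ → ∃ c : ℝ, 0 < c ∧ ∀ᶠ N : ℕ in Filter.atTop, ∃ δ : ENNReal, 0 < δ ∧ ∀ Ψ : Literature.MathematicalPhysics.QuantumManyBody.BoseGas.PeriodicTrialState N (Literature.MathematicalPhysics.QuantumManyBody.BoseGas.sideLength ρ N), Literature.MathematicalPhysics.QuantumManyBody.BoseGas.periodicEnergy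 v Ψ ≤ Literature.MathematicalPhysics.QuantumManyBody.BoseGas.periodicGroundStateEnergy v N (Literature.MathematicalPhysics.QuantumManyBody.BoseGas.sideLength ρ N) + δ → ENNReal.ofReal (c * N) ≤ Literature.MathematicalPhysics.QuantumManyBody.BoseGas.condensateOccupation N (Literature.MathematicalPhysics.QuantumManyBody.BoseGas.sideLength ρ N) Ψ.ψ

/-- item stmt-AtomisticToContinuum-12689 · assembly · rank 1 · open · by planner
sources: LiebSeiringerSolovejYngvason2005
[assembly] EnergyExcessDecay → SoftShellRelaxation → HardModeBounds → TransportBookkeeping →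
PeriodicRigidity → RigidityUpgrade → BoundaryTransferWeak → BoseEinsteinCondensation. -/
@[route_item "route-AtomisticToContinuum-BECCovarianceTransport"]
def Assembly : Prop :=
  EnergyExcessDecay → SoftShellRelaxation → HardModeBounds → TransportBookkeeping → PeriodicRigidity → RigidityUpgrade → BoundaryTransferWeak → BoseEinsteinCondensation

/-! D-0027 §2.1 — DECIDING THEOREM (planner-authored via `route open/edit --closes-file`; by planner-plancard-AtomisticToContinuum-BoseEin-4e560c3c-g2-0 2026-08-15T18:58:30Z):
its hypotheses are this route's items and its conclusion the sub-problem Statement (glue_lint), and it elaborates with this file. -/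

@[closes "route-AtomisticToContinuum-BECCovarianceTransport"] theorem closes (h₁ : EnergyExcessDecay) (h₂ : SoftShellRelaxation) (h₃ : HardModeBounds) (h₄ : TransportBookkeeping) (h₅ : PeriodicRigidity) (h₆ : RigidityUpgrade) (h₇ : BoundaryTransferWeak) : BoseEinsteinCondensation :=
  fun v hv => h₇ v hv (h₆ (h₄ h₁ h₂ h₃) h₅ v hv)

end Summit.AtomisticToContinuum.BoseEinsteinCondensation.Theses.BECCovarianceTransport
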